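import Summits.BirchSwinnertonDyer.Rank1Residual.GaloisImage.CanonicalKolyvaginDatum
import Summits.BirchSwinnertonDyer.Rank1Residual.GaloisImage.KolyvaginDeepSubclassTransport
import Summits.BirchSwinnertonDyer.Rank1Residual.GaloisImage.KolyvaginPrimeLocalShape
import Summits.BirchSwinnertonDyer.Rank1Residual.GaloisImage.KolyvaginPrimeLocalShapeRatHolds
import Summits.BirchSwinnertonDyer.Rank1Residual.GaloisImage.SakamotoN11Instance
import HarnessLib

/-!
# S24-DEEP adapters: the Kolyvagin datum on the DEEP Frobenius sub-class, with THE canonical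
# comparison maps, and Rubin's local shape `#H¹_ur(ℚ_𝔮, T) = #𝒯_𝔮` on it
# (cell `b2b-bsdres`, team n1011, seat p15 GEN 3, OWNERS row T-S24D = route planner 1's R1-47 (b)(c),
# `cells/n1011/ROUTE-1.md` §27.6 / §28.4; file 1 of the row)

HONEST FRAMING (cell `b2b-bsdres`, run/shared/lean/b2b/bsd-rank1-residual/, verbatim in every
file): the goal of the cell is to DELETE the COMBINATION-SHAPED residual classes of the
Birch–Swinnerton-Dyer formula for ALL analytic-rank `≤ 1` elliptic curves over `ℚ` — "full BSD
formula for every rank `≤ 1` curve in class `C`" assembled STRICTLY from published theorems — so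
that the rank-`≤ 1` remainder becomes exactly the CONSTRUCTION-SHAPED classes, which are TYPED
(missing-input `Prop`s), NOT attempted. This is not "finishing BSD". Team n1011 (N10 / N11, the
additive block X4 ∧ `p = 3`): research route on the CONSTRUCTION-SHAPED class X4; TOOL theorems of
local Galois cohomology; no class theorem; nothing is booked; no label and no RESIDUAL-MAP mark is
moved. Theorems only: no definition, no named fact, no `sorry`.

## What and why

The END THEOREM of sub-route (a′), n1011-p18's `Assembly.padicValRat_le_of_certificate_of_transport`
(`KuriharaLowerBoundThreeOfTransport.lean`, p271924), takes at every depth `k′` a DEEP Kolyvagin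
datum `D′_{k′}` for the module `T = E[3^{k′+1}]` together with its SHAPE: cyclotomic transverse
conditions (`hDT′`), primes inside the shallow class (`hPP′`), primes off the admissible set (`hPS′`)
and Rubin's local shape `#H¹_ur(ℚ_𝔮, T) = #𝒯_𝔮` at its primes (`hUT′`).  On class-A2 rows
(`E(ℚ₃)[3] ≠ 0`, cell convention (B6)) the primes of `D′_{k′}` are NOT Sakamoto's class pinned to the
module but the DEEP sub-class cut out one or more levels up,
  `𝒫′ = frobeniusClassPrimes ρ′ S τ N′ ⊆ 𝒫 = frobeniusClassPrimes ρ S τ N`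
(`ker ρ′ ≤ ker ρ`, `N ∣ N′`; think `T = E[3^m]`, `T′ = E[3^{m′}]`, `N = 3^m`, `N′ = 3^{m′}`), the
setting of the typed PORT `S24Deep.kolyvaginSystems_freeRankOne_zmod_three_pow_deep`
(`KolyvaginDeepSubclass.lean`, cc-typer-1, p268594).  This file supplies, with NO hypothesis beyond
Sakamoto's (H.2) datum `τ` (`τ ∈ Gal(ℚ̄/ℚ(μ_{N′}))`, `T/(τ − 1)T ≅ ℤ/N`):

* `exists_kolyvaginDatum_hasCanonicalComparison_frobeniusClassPrimes_deep` /
  `exists_eta_kolyvaginDatum_hasCanonicalComparison_frobeniusClassPrimes_deep` — **the deep datum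
  EXISTS with THE canonical finite–singular comparison maps at the module's level `N`**: n1011-p04's
  generic-`𝒫` constructor `FSComp.exists_kolyvaginDatum_hasCanonicalComparison` fed, at each
  `𝔮 ∈ 𝒫′`, through cc-typer-1's `S24Deep.frobeniusClassPrimes_mono` (`𝒫′ ⊆ 𝒫`): `T` unramified at
  `𝔮`, `N ∣ ℓ − 1 = ord η_𝔮` (`FSComp.dvd_orderOf_of_mem_frobeniusClassPrimes`), `P(1) = 0`
  (`FSComp.eval_one_comparisonP_toLocal_eq_zero`);
* `natCard_unramifiedSubgroup_toLocal_of_mem_frobeniusClassPrimes_deep`,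
  `natCard_cyclotomicTransverse_of_mem_frobeniusClassPrimes_deep`,
  `natCard_unramifiedSubgroup_eq_natCard_transverse_of_primes_eq_deep` — **Rubin's local shape on deep
  data**: `#H¹_ur(ℚ_𝔮, T) = N = #𝒯_𝔮` at every prime of the deep datum (n1011-p18's
  `natCard_unramifiedSubgroup_toLocal_of_mem_frobeniusClassPrimes`, Rubin Prop. 1.4.13 (1), and the
  cell's unconditional `ℚ`-reading of Rubin Prop. 1.9.5 (1)
  `natCard_cyclotomicTransverse_rat_of_mem_frobeniusClassPrimes'`, through the same inclusion);
* the N11 spellings for an elliptic curve (`T = E[3^{k+1}] = geomTorsion W ((3:ℤ)^k·3)`, class through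
  `E[3^{k′+1}]` at `3^{k′+1}`, `k ≤ k′`): `exists_eta_kolyvaginDatum_torsion_pow_mul_deep`,
  `natCard_unramifiedSubgroup_eq_natCard_transverse_torsion_pow_mul_deep`, `not_mem_of_mem_primes_deep`
  — the binders `D′`, `hDT′`, `hUT′`, `hPS′` of p271924 at one depth, and `hPP′` in the form
  `primes_subset_torsion_pow_mul_deep`.

Nothing here uses or asserts the S24-DEEP port; the port's CONSUMER instance is file 2 of the row
(`SakamotoN11InstanceDeep.lean`).

References: R. Sakamoto, JTNB **36** (2024) §2 (pp. 920–921: `H_α`, (H.2), the set `𝒫`), §4 p. 925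
("for any prime `𝔮 ∈ 𝒫`, `H¹_ur(K_𝔮, T) ≅ T/(Fr_𝔮 − 1)T ≅ R`") [Sakamoto2024]; K. Rubin, PCMI **18**
(2011) Prop. 1.4.13 (1), Prop. 1.9.5 (1), Def. 1.9.6, Def. 2.1.3 [Rubin2011]; B. Mazur, K. Rubin,
Mem. AMS **799** (2004) §3.5 (H.5), Prop. A.2 [MazurRubin2004]; C.-H. Kim, AJM **148** (2026) §2.2.2
[Kim2022StructureSelmer].
-/

noncomputable section

open scoped Classical NumberField ContRepresentation
open Field NumberField IsDedekindDomain
open Literature.NumberTheory.GaloisRepresentations Literature.NumberTheory.GaloisRepresentations.DiscreteGaloisModule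
  Literature.NumberTheory.GaloisCohomology

namespace Summit.BirchSwinnertonDyer.Rank1Residual.GaloisImage.S24Deep

/-! ### Generic over `ℚ`: module `ρ` at level `N`, class through `ρ′` at level `N′` -/

section Generic

variable {M : Type} [AddCommGroup M] [TopologicalSpace M] [DiscreteTopology M]
variable {M' : Type} [AddCommGroup M'] [TopologicalSpace M'] [DiscreteTopology M']
variable (ρ : DiscreteGaloisModule ℚ M) (ρ' : DiscreteGaloisModule ℚ M') (N N' : ℕ) [NeZero N]

section Datum

variable [Module (ZMod N) M] [Module.Free (ZMod N) M] [Module.Finite (ZMod N) M]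

/-- **The Kolyvagin datum on the DEEP sub-class with THE canonical comparison maps EXISTS.**  For a
discrete `Γ_ℚ`-module `T` free of finite rank over `ℤ/N`, an auxiliary module `T′` with
`ker ρ_{T′} ≤ ker ρ_T`, levels `N ∣ N′`, `τ ∈ Gal(ℚ̄/ℚ(μ_{N′}))` with `T/(τ − 1)T ≅ ℤ/N`, any `S`, any
transverse structure `𝒯` and primitive roots `η_ℓ` at the primes of the deep class
`𝒫′ = frobeniusClassPrimes ρ′ S τ N′`: there is `D : KolyvaginDatum ρ` with `D.primes = 𝒫′`,
`D.transverse = 𝒯` and `D.HasCanonicalComparison N η` (Rubin Def. 1.9.6 at every `𝔮 ∈ 𝒫′`).  Every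
input of the generic constructor is inherited from the pinned class `𝒫 ⊇ 𝒫′`
(`frobeniusClassPrimes_mono`): unramified, `N ∣ ord η_𝔮 = ℓ − 1`, `P(1) = det(1 − Fr_𝔮 | T) = 0`.
[cite: Rubin2011, Def. 1.9.6 (p. 14) and Def. 2.1.3 (p. 17)] [cite: Sakamoto2024, §2 (pp. 920–921) and §4 (p. 925)] -/
theorem exists_kolyvaginDatum_hasCanonicalComparison_frobeniusClassPrimes_deep
    (hker : ∀ u : absoluteGaloisGroup ℚ, ρ' u = 1 → ρ u = 1) (hNN' : N ∣ N')
    (S : Set (HeightOneSpectrum (𝓞 ℚ))) {τ : absoluteGaloisGroup ℚ}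
    (hτ : τ ∈ rootsOfUnityFixer ℚ N') (hcoker : Nonempty (cokerSubOne ρ τ ≃+ ZMod N))
    (T : SelmerStructure ρ) (η : (q : HeightOneSpectrum (𝓞 ℚ)) → (ZMod (Ideal.absNorm q.asIdeal))ˣ)
    (hη : ∀ q ∈ frobeniusClassPrimes ρ' S τ N', Subgroup.zpowers (η q) = ⊤) :
    ∃ D : KolyvaginDatum ρ, D.primes = frobeniusClassPrimes ρ' S τ N' ∧ D.transverse = T ∧
      D.HasCanonicalComparison N η := by
  have hsub := frobeniusClassPrimes_mono ρ ρ' hker S τ hNN'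
  have hτN : τ ∈ rootsOfUnityFixer ℚ N := rootsOfUnityFixer_le_of_dvd ℚ hNN' hτ
  exact FSComp.exists_kolyvaginDatum_hasCanonicalComparison ρ N _ T η hη
    (fun q hq => FSComp.dvd_orderOf_of_mem_frobeniusClassPrimes ρ N S hτN (hsub hq) (η q) (hη q hq))
    (fun q hq => (hsub hq).2.2.1)
    (fun q hq φ hφ => FSComp.eval_one_comparisonP_toLocal_eq_zero ρ N S τ hcoker (hsub hq) φ hφ)

/-- **Primitive roots included** (Kim's choice of `η_ℓ`, AJM 148 §2.2.2, made by `Classical.choice`;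
`(ℤ/ℓ)ˣ` is cyclic and `N𝔮 = ℓ` is prime over `ℚ`): `∃ η D`, `D.primes = 𝒫′`, `D.transverse = 𝒯`,
`D.HasCanonicalComparison N η`. [cite: Kim2022StructureSelmer, §2.2.2] [cite: Rubin2011, Def. 1.9.6 (p. 14)] -/
theorem exists_eta_kolyvaginDatum_hasCanonicalComparison_frobeniusClassPrimes_deep
    (hker : ∀ u : absoluteGaloisGroup ℚ, ρ' u = 1 → ρ u = 1) (hNN' : N ∣ N')
    (S : Set (HeightOneSpectrum (𝓞 ℚ))) {τ : absoluteGaloisGroup ℚ}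
    (hτ : τ ∈ rootsOfUnityFixer ℚ N') (hcoker : Nonempty (cokerSubOne ρ τ ≃+ ZMod N))
    (T : SelmerStructure ρ) :
    ∃ (η : (q : HeightOneSpectrum (𝓞 ℚ)) → (ZMod (Ideal.absNorm q.asIdeal))ˣ) (D : KolyvaginDatum ρ),
      D.primes = frobeniusClassPrimes ρ' S τ N' ∧ D.transverse = T ∧
        D.HasCanonicalComparison N η := by
  have hgen : ∀ q : HeightOneSpectrum (𝓞 ℚ), ∃ η : (ZMod (Ideal.absNorm q.asIdeal))ˣ,
      Subgroup.zpowers η = ⊤ := fun q => by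
    haveI : Fact (Ideal.absNorm q.asIdeal).Prime := ⟨FSComp.prime_absNorm_rat q⟩
    obtain ⟨g, hg⟩ := IsCyclic.exists_generator (α := (ZMod (Ideal.absNorm q.asIdeal))ˣ)
    exact ⟨g, (Subgroup.eq_top_iff' _).mpr hg⟩
  choose η hη using hgen
  exact ⟨η, exists_kolyvaginDatum_hasCanonicalComparison_frobeniusClassPrimes_deep ρ ρ' N N' hker
    hNN' S hτ hcoker T η fun q _ => hη q⟩

/-! Conservativity (route planner 1 §29.3 (4)): at `(ρ′, N′) = (ρ, N)` the deep datum IS n1011-p04's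
generic-`𝒫` datum on the pinned class — the class-A1 path is literally unchanged. -/
example (S : Set (HeightOneSpectrum (𝓞 ℚ))) {τ : absoluteGaloisGroup ℚ}
    (hτ : τ ∈ rootsOfUnityFixer ℚ N) (hcoker : Nonempty (cokerSubOne ρ τ ≃+ ZMod N))
    (T : SelmerStructure ρ) (η : (q : HeightOneSpectrum (𝓞 ℚ)) → (ZMod (Ideal.absNorm q.asIdeal))ˣ)
    (hη : ∀ q ∈ frobeniusClassPrimes ρ S τ N, Subgroup.zpowers (η q) = ⊤) :
    ∃ D : KolyvaginDatum ρ, D.primes = frobeniusClassPrimes ρ S τ N ∧ D.transverse = T ∧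
      D.HasCanonicalComparison N η :=
  exists_kolyvaginDatum_hasCanonicalComparison_frobeniusClassPrimes_deep ρ ρ N N (fun _ h => h)
    dvd_rfl S hτ hcoker T η hη

end Datum

/-! ### Rubin's local shape at the primes of the deep class -/

section LocalShape

variable [Finite M]

omit [NeZero N] in
/-- **(U) on the deep class**: `#H¹_ur(ℚ_𝔮, T) = N` at every `𝔮 ∈ frobeniusClassPrimes ρ′ S τ N′`
(`ker ρ′ ≤ ker ρ`, `N ∣ N′`, `T/(τ − 1)T ≅ ℤ/N`) — n1011-p18's
`natCard_unramifiedSubgroup_toLocal_of_mem_frobeniusClassPrimes` (Rubin Prop. 1.4.13 (1)) at the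
image of `𝔮` in the pinned class. [cite: Rubin2011, Prop. 1.4.13 (1) (p. 9) and Def. 2.1.3 (p. 17)]
[cite: Sakamoto2024, §4 (p. 925)] -/
theorem natCard_unramifiedSubgroup_toLocal_of_mem_frobeniusClassPrimes_deep
    (hker : ∀ u : absoluteGaloisGroup ℚ, ρ' u = 1 → ρ u = 1) (hNN' : N ∣ N')
    {S : Set (HeightOneSpectrum (𝓞 ℚ))} {τ : absoluteGaloisGroup ℚ}
    (hcoker : Nonempty (cokerSubOne ρ τ ≃+ ZMod N)) {q : HeightOneSpectrum (𝓞 ℚ)}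
    (hq : q ∈ frobeniusClassPrimes ρ' S τ N') :
    Nat.card (unramifiedSubgroup (GaloisRep.toLocal q ρ) 1) = N :=
  natCard_unramifiedSubgroup_toLocal_of_mem_frobeniusClassPrimes ρ
    (frobeniusClassPrimes_mono ρ ρ' hker S τ hNN' hq) hcoker

/-- **(T) on the deep class** (the `K = ℚ` reading of Rubin Prop. 1.9.5 (1), unconditional in the
tree): `#𝒯_𝔮 = N` for the cyclotomic transverse condition of a module KILLED BY `N`, at every
`𝔮 ∈ frobeniusClassPrimes ρ′ S τ N′` with `τ ∈ Gal(ℚ̄/ℚ(μ_{N′}))`, `T/(τ − 1)T ≅ ℤ/N`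
(`(ℓ − 1)T = 0` because `N ∣ ℓ − 1`). [cite: Rubin2011, Prop. 1.9.5 (1) (p. 16)] -/
theorem natCard_cyclotomicTransverse_of_mem_frobeniusClassPrimes_deep
    (hker : ∀ u : absoluteGaloisGroup ℚ, ρ' u = 1 → ρ u = 1) (hNN' : N ∣ N')
    {S : Set (HeightOneSpectrum (𝓞 ℚ))} {τ : absoluteGaloisGroup ℚ}
    (hτ : τ ∈ rootsOfUnityFixer ℚ N') (hcoker : Nonempty (cokerSubOne ρ τ ≃+ ZMod N))
    (hMN : ∀ m : M, N • m = 0) {q : HeightOneSpectrum (𝓞 ℚ)}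
    (hq : q ∈ frobeniusClassPrimes ρ' S τ N') :
    Nat.card (cyclotomicTransverse ρ (Sum.inr q)) = N := by
  have hq' := frobeniusClassPrimes_mono ρ ρ' hker S τ hNN' hq
  exact natCard_cyclotomicTransverse_rat_of_mem_frobeniusClassPrimes' ρ hq' hcoker
    (absNorm_sub_one_smul_eq_zero_of_mem_frobeniusClassPrimes ρ hq'
      (rootsOfUnityFixer_le_of_dvd ℚ hNN' hτ) hMN)

/-- **The binder `hUT′` of the END theorem on deep data**: for a Kolyvagin datum of the module `T`
(killed by `N`) whose primes are the DEEP class `frobeniusClassPrimes ρ′ S τ N′` and whose transverse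
structure is the cyclotomic one, `#H¹_ur(ℚ_𝔮, T) = #𝒯_𝔮` (both `= N`) at every prime of the datum —
Rubin's local shape, Ex. 1.9.7 / Sakamoto §4 p. 925, inherited by the sub-class.
[cite: Rubin2011, Prop. 1.4.13 (1) (p. 9) and Prop. 1.9.5 (1) (p. 16)] [cite: Sakamoto2024, §4 (p. 925)] -/
theorem natCard_unramifiedSubgroup_eq_natCard_transverse_of_primes_eq_deep
    (hker : ∀ u : absoluteGaloisGroup ℚ, ρ' u = 1 → ρ u = 1) (hNN' : N ∣ N')
    {D : KolyvaginDatum ρ} {S : Set (HeightOneSpectrum (𝓞 ℚ))} {τ : absoluteGaloisGroup ℚ}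
    (hP : D.primes = frobeniusClassPrimes ρ' S τ N') (hT : D.transverse = cyclotomicTransverse ρ)
    (hτ : τ ∈ rootsOfUnityFixer ℚ N') (hcoker : Nonempty (cokerSubOne ρ τ ≃+ ZMod N))
    (hMN : ∀ m : M, N • m = 0) :
    ∀ q ∈ D.primes, Nat.card (unramifiedSubgroup (GaloisRep.toLocal q ρ) 1) =
      Nat.card (D.transverse (Sum.inr q)) := fun q hq => by
  rw [hP] at hq
  rw [natCard_unramifiedSubgroup_toLocal_of_mem_frobeniusClassPrimes_deep ρ ρ' N N' hker hNN' hcoker hq,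
    hT, natCard_cyclotomicTransverse_of_mem_frobeniusClassPrimes_deep ρ ρ' N N' hker hNN' hτ hcoker hMN hq]

omit [NeZero N] [Finite M] in
/-- **The binder `hPS′` of the END theorem on deep data**: the primes of a datum on the class
`frobeniusClassPrimes ρ′ S τ N′` lie off `S` (built into the class). [cite: Sakamoto2024, §2 (p. 921)] -/
theorem not_mem_of_primes_eq_deep {D : KolyvaginDatum ρ} {S : Set (HeightOneSpectrum (𝓞 ℚ))}
    {τ : absoluteGaloisGroup ℚ} (hP : D.primes = frobeniusClassPrimes ρ' S τ N') :
    ∀ q ∈ D.primes, q ∉ S := fun q hq => by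
  rw [hP] at hq
  exact hq.1

end LocalShape

end Generic

/-! ### The N11 spellings: `T = E[3^{k+1}]`, class through `E[3^{k′+1}]` at `3^{k′+1}`, `k ≤ k′` -/

section Torsion

open WeierstrassCurve Literature.NumberTheory.EllipticCurves

variable (W : WeierstrassCurve ℚ) [W.IsElliptic]

/-- **The deep N11 datum EXISTS** (binder `D′ k′` of p271924 with `hDT′` and the canonical comparison,
one depth): for `k ≤ k′`, `τ ∈ Gal(ℚ̄/ℚ(μ_{3^{k′+1}}))` with `E[3^{k+1}]/(τ − 1) ≅ ℤ/3^{k+1}` and any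
`S`, there are primitive roots `η` and a Kolyvagin datum `D` for `E[3^{k+1}]` with
`D.primes = frobeniusClassPrimes (E[3^{k′+1}]) S τ 3^{k′+1}` (the DEEP class), cyclotomic transverse
conditions and `D.HasCanonicalComparison 3^{k+1} η`.
[cite: Rubin2011, Def. 1.9.6 (p. 14) and Def. 2.1.3 (p. 17)] [cite: MazurRubin2004, §3.5 (H.5) (p. 27) and Prop. A.2 (pp. 79–80)] -/
theorem exists_eta_kolyvaginDatum_torsion_pow_mul_deep {k k' : ℕ} (hk : k ≤ k')
    (S : Set (HeightOneSpectrum (𝓞 ℚ))) {τ : absoluteGaloisGroup ℚ}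
    (hτμ : τ ∈ rootsOfUnityFixer ℚ (3 ^ (k' + 1)))
    (hτq : Nonempty (cokerSubOne (W.torsionGaloisModule (((3 : ℕ) : ℤ) ^ k * ((3 : ℕ) : ℤ))) τ ≃+
      ZMod (3 ^ (k + 1)))) :
    ∃ (η : (q : HeightOneSpectrum (𝓞 ℚ)) → (ZMod (Ideal.absNorm q.asIdeal))ˣ)
      (D : KolyvaginDatum (W.torsionGaloisModule (((3 : ℕ) : ℤ) ^ k * ((3 : ℕ) : ℤ)))),
      D.primes = frobeniusClassPrimes (W.torsionGaloisModule (((3 : ℕ) : ℤ) ^ k' * ((3 : ℕ) : ℤ)))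
          S τ (3 ^ (k' + 1)) ∧
        D.transverse = cyclotomicTransverse _ ∧ D.HasCanonicalComparison (3 ^ (k + 1)) η :=
  haveI : NeZero (3 ^ (k + 1)) := ⟨pow_ne_zero _ three_ne_zero⟩
  exists_eta_kolyvaginDatum_hasCanonicalComparison_frobeniusClassPrimes_deep _ _ _ _
    (fun u hu => torsionGaloisModule_pow_mul_eq_one_of_le W ((3 : ℕ) : ℤ) hk u hu)
    (pow_dvd_pow 3 (Nat.succ_le_succ hk)) S hτμ hτq _

omit [W.IsElliptic] in
/-- **`hPP′`-shape**: the deep class through `E[3^{k′+1}]` at `3^{k′+1}` lies inside the class through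
`E[3^{k+1}]` at `3^{k+1}` (`k ≤ k′`; cc-typer-1's `frobeniusClassPrimes_torsion_pow_mul_mono`), so a
datum on the former has its primes inside those of any datum on the latter with the same `S`, `τ`.
[cite: MazurRubin2004, §3.5 (H.5) (p. 27)] -/
theorem primes_subset_torsion_pow_mul_deep {k' k'' : ℕ} (hk : k' ≤ k'')
    {S : Set (HeightOneSpectrum (𝓞 ℚ))} {τ : absoluteGaloisGroup ℚ} {n n' : ℤ}
    {D : KolyvaginDatum (W.torsionGaloisModule n)} {D' : KolyvaginDatum (W.torsionGaloisModule n')}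
    (hP : D.primes = frobeniusClassPrimes (W.torsionGaloisModule (((3 : ℕ) : ℤ) ^ k' * ((3 : ℕ) : ℤ)))
      S τ (3 ^ (k' + 1)))
    (hP' : D'.primes = frobeniusClassPrimes (W.torsionGaloisModule (((3 : ℕ) : ℤ) ^ k'' * ((3 : ℕ) : ℤ)))
      S τ (3 ^ (k'' + 1))) :
    D'.primes ⊆ D.primes := by
  rw [hP, hP']
  exact frobeniusClassPrimes_torsion_pow_mul_mono W ((3 : ℕ) : ℤ) hk S τ
    (pow_dvd_pow 3 (Nat.succ_le_succ hk))

/-- **`hUT′` of p271924 at one depth, on deep data**: for a Kolyvagin datum of `E[3^{k+1}]` on the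
deep class through `E[3^{k′+1}]` (`k ≤ k′`) with cyclotomic transverse conditions,
`#H¹_ur(ℚ_𝔮, E[3^{k+1}]) = #𝒯_𝔮` at every prime of the datum.
[cite: Rubin2011, Prop. 1.4.13 (1) (p. 9) and Prop. 1.9.5 (1) (p. 16)] [cite: Sakamoto2024, §4 (p. 925)] -/
theorem natCard_unramifiedSubgroup_eq_natCard_transverse_torsion_pow_mul_deep {k k' : ℕ} (hk : k ≤ k')
    {D : KolyvaginDatum (W.torsionGaloisModule (((3 : ℕ) : ℤ) ^ k * ((3 : ℕ) : ℤ)))}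
    {S : Set (HeightOneSpectrum (𝓞 ℚ))} {τ : absoluteGaloisGroup ℚ}
    (hP : D.primes = frobeniusClassPrimes (W.torsionGaloisModule (((3 : ℕ) : ℤ) ^ k' * ((3 : ℕ) : ℤ)))
      S τ (3 ^ (k' + 1)))
    (hT : D.transverse = cyclotomicTransverse _)
    (hτμ : τ ∈ rootsOfUnityFixer ℚ (3 ^ (k' + 1)))
    (hτq : Nonempty (cokerSubOne (W.torsionGaloisModule (((3 : ℕ) : ℤ) ^ k * ((3 : ℕ) : ℤ))) τ ≃+
      ZMod (3 ^ (k + 1)))) :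
    ∀ q ∈ D.primes,
      Nat.card (unramifiedSubgroup (GaloisRep.toLocal q
        (W.torsionGaloisModule (((3 : ℕ) : ℤ) ^ k * ((3 : ℕ) : ℤ)))) 1) =
        Nat.card (D.transverse (Sum.inr q)) :=
  haveI : NeZero (3 ^ (k + 1)) := ⟨pow_ne_zero _ three_ne_zero⟩
  haveI := finite_geomTorsion_pow_mul W 3 k
  natCard_unramifiedSubgroup_eq_natCard_transverse_of_primes_eq_deep _ _ _ _
    (fun u hu => torsionGaloisModule_pow_mul_eq_one_of_le W ((3 : ℕ) : ℤ) hk u hu)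
    (pow_dvd_pow 3 (Nat.succ_le_succ hk)) hP hT hτμ hτq (pow_succ_nsmul_geomTorsion_eq_zero W 3 k)

end Torsion

end Summit.BirchSwinnertonDyer.Rank1Residual.GaloisImage.S24Deep

end
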